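import Literature.ComputerArithmetic.Rump2006.CholeskyPositiveDefinite
import Literature.LinearAlgebra.Matrix.BauerFike

/-!
# Oishi–Rump 2002: a-priori backward-error bounds for triangular substitution and LU in ANY order
# of evaluation, and the `2/3 n³`-flop verification of nonsingularity / of `‖A⁻¹b - x̃‖_∞`

HONEST FRAMING (ENGINES group, engine `cap`, part CAP-2): shared numerical engines serving client
cells; rigour lives in the verifiers; every published number belongs to a client cell's ledger, not
to the engines group. A Literature module: published theorems re-proved in the kernel, no named facts,
no `sorry`. It continues `Literature.ComputerArithmetic.Rump2006.CholeskyPositiveDefinite` (the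
any-order evaluation grammar `CTree` / `STree`, the envelopes `Band`, Higham's `γ_n`) from Cholesky to
the two other classical kernels — substitution for triangular systems and Gaussian elimination — and
to the verification method that is built on their a-priori bounds.

SOURCES (read from the held texts). S. Oishi, S. M. Rump, *Fast verification of solutions of matrix
equations*, Numer. Math. 90 (2002) 755–773 [OishiRump2002] (author version, pp. 1–3, 6–7, 12–14):

> (3) `‖RA - I‖_∞ < 1` […] then `A⁻¹` exists, and using `A⁻¹ = (I - (I - RA))⁻¹ R` the following
> inequalities hold: (4) `‖A⁻¹‖_∞ ≤ ‖R‖_∞ / (1 - ‖RA - I‖_∞)`,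
> `‖A⁻¹b - x̃‖_∞ ≤ ‖R(Ax̃ - b)‖_∞ / (1 - ‖RA - I‖_∞)`.
> (5) `fl(x op y) = (x op y)(1 + δ₁) + η₁ = (x op y)/(1 + δ₂) + η₂` […] `|δ_i| ≤ u`, `|η_i| ≤ u̲`.
> §4: (13) `‖X_U X_L P A - I‖_∞ ≤ ‖X_U X_L (PA - LU)‖_∞ + ‖X_U (X_L L - I) U‖_∞ + ‖X_U U - I‖_∞`.
> […] consider Doolittle's method (Algorithm 9.2 in [6]) `U_kj = A_kj - Σ_{i<k} L_ki U_ij` (`j ≥ k`),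
> `L_ik = (A_ik - Σ_{j<k} L_ij U_jk)/U_kk` (`i > k`). Every other, mathematically equivalent variant of
> Gaussian elimination implements the same formulas to compute `U_kj` and `L_ik`, only in a different
> order of computation. […] Gaussian elimination with pivoting is equivalent to Gaussian elimination
> without pivoting applied to a permuted matrix.
> **Theorem 4.1.** For given `n × n` real matrix `A` suppose `L, U` are computed by some variant of
> Gaussian elimination such that `PA ≈ LU`, where `P` is a permutation matrix storing pivoting
> information. If `nu < 1`, then, also in the presence of underflow,
> (14) `|PA - LU| ≤ γ_n · |L| · |U| + (n e + diag(|U|)) eᵀ u̲ / (1 - nu)`.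
> **Theorem 4.2.** Let a nonsingular triangular `n × n` matrix `T` be given, and suppose, the rows
> `x_iᵀ` of an approximate inverse `X` are computed by substitution, in any order, of `n` linear systems
> `Tᵀ · x_i = e_i` […] Then, including possible underflow, (15) `|XT - I| ≤ γ_n |X| |T| + …u̲`.
> For unit triangular `T` it is (16) `|XT - I| ≤ γ_n |X| |T| + …u̲`.
> **Proposition 4.3.** […] `L, U` computed by some variant of Gaussian elimination with partial
> pivoting […] `LU ≈ PA`. Suppose `X_L, X_U` are rowwise computed inverses of `L, U`, respectively by
> successive solution of `Lᵀx = e_i`, `Uᵀx = e_i`. Assume `nu < 1`. Then […] bounds for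
> `α := ‖X_U X_L P A - I‖_∞` can be computed in `O(n²)` flops by
> (17) `α ≤ 2γ_n ‖ |X_U|(|X_L|(|L|(|U|e))) ‖_∞ + γ_n ‖ |X_U|(|U|e) ‖_∞ + ε · u̲`.
> §5: `α < 1` implies `A` to be nonsingular and then `β/(1 - α)` is an upper bound for `‖A⁻¹b - x̃‖_∞`.
> §7 Appendix. **Lemma 7.1.** Let `ỹ = (c - Σ_{i<k} a_i b_i)/b_k` be evaluated in floating point. Then
> the computed `ỹ`, no matter what the order of evaluation and including possible underflow, satisfies
> (19) `b_k ỹ (1 + Θ_k^{(0)}) = c - Σ_{i<k} a_i b_i (1 + Θ_{k-1}^{(i)}) + …η…` where `|Θ_j^{(i)}| ≤ γ_j`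
> […] If `b_k = 1`, so that there is no division, then `|Θ_j^{(i)}| ≤ γ_{j-1}` for all `i, j`.
> [it "extends Lemmata 8.2 and 8.4 in [6]" = Higham, *Accuracy and Stability of Numerical Algorithms*]
> **Corollary 7.2.** (22) `|c - Σ_{i<k} a_i b_i - b_k ỹ| ≤ γ_k (Σ|a_i b_i| + |b_k ỹ|) + (k + |b_k|) u̲/(1-ku)`;
> for `b_k = 1`: (23) `… ≤ γ_k (Σ |a_i b_i| + |b_k ỹ|) + ku̲/(1 - ku)`.
> **Lemma 7.3.** Let a linear system `Tx = b` with triangular matrix `T` be solved by backward or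
> forward substitution, respectively. Then no matter what the order of evaluation and including
> underflow, the computed solution `x̃` satisfies `|b - T x̃| ≤ γ_n |T| |x̃| + (ne + diag(|T|)) u̲/(1-nu)`
> […] For unit triangular `T` it is `|b - T x̃| ≤ γ_n |T| |x̃| + ne u̲/(1 - nu)`. *Proof.* The `k`-th
> elimination step, e.g. for lower triangular `T`, is `x̃_k = fl((b_k - Σ_{i<k} T_ki x̃_i)/T_kk)`.

T. Ogita, S. Oishi, *Fast verified solutions of linear systems*, Japan J. Indust. Appl. Math. 26
(2009) 169–190 [OgitaOishi2009], §4.2 (pp. 178–179): (4.5) `|PA - LU| ≤ γ_n |L||U|`, (4.6)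
`|I - X_T T| ≤ γ_n |X_T||T|` "for a triangular matrix equation `XT = I` solved by standard forward /
backward substitution", the Oishi–Rump chain leading to (4.7)
`‖I - RA‖_∞ ≤ γ_n ‖2|X_U|(|X_L|(|L|(|U|e))) + |X_U|(|U|e)‖_∞ + c₁u̲`, `R := X_U X_L P`, and the
Ogita–Oishi variant (4.8) `‖I - RA‖_∞ ≤ ‖ |X_U|((|X_L P A - U| + γ_n|U|)e) ‖_∞ + c₂u̲`.
N. J. Higham, *Accuracy and Stability of Numerical Algorithms*, 2nd ed. [Higham2002ASNA]: Lemma 8.4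
(the substitution kernel "no matter what the order of evaluation"), Theorem 8.5 (substitution with
any ordering: `(T + ΔT)x̂ = b`, `|ΔT| ≤ γ_n|T|`; quoted as "Lemma 4 (Rounding error in solving
triangular systems [Higham])" on p. 5 of arXiv:2408.06311, and as (2.3) of Higham, *Stability of
parallel triangular system solvers*, SIAM J. Sci. Comput. 16 (1995)), Theorem 9.3 (`L̂Û = A + ΔA`,
`|ΔA| ≤ γ_n |L̂||Û|`, Doolittle's method Algorithm 9.2).

MODEL AND READING. Exactly the model of `Rump2006.CholeskyPositiveDefinite`: `K` is any linearly
ordered field; THE STANDARD MODEL WITHOUT UNDERFLOW (`u̲ = 0`, i.e. `η_i = 0` in (5)): every theorem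
below is the `u̲ = 0` reading of the printed one — the `…u̲` terms of (14)–(17), (19), (22)–(23) and
Lemma 7.3 are dropped, the `γ_n` terms are kept verbatim (and, where the printed proof yields them,
the sharper split constants `γ_{k-1}` / `γ_k` of Lemma 7.1 are recorded as well). ANY ORDER OF
EVALUATION: each computed quantity `fl(c - Σ_ℓ z_ℓ)` is the value of an arbitrary well-formed `CTree`
(rounded partial sums of disjoint blocks of the products subtracted one at a time from `c`, fused
multiply–add allowed), which contains Oishi–Rump's "no matter what the order of evaluation", every
`ijk` variant of Gaussian elimination ("only in a different order of computation"), and blocked /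
vectorised kernels. SUBSTITUTION is typed as a ROW SWEEP (`SubstSweep`): row `i` computes
`x̃_i = fl((b_i - Σ_{j ∈ J_i} T_ij x̃_j)/T_ii)` for some duplicate-free index list `J_i ∌ i` containing
every `j ≠ i` with `T_ij ≠ 0` — forward substitution (`T` lower triangular, `J_i = {j < i}`), backward
substitution (`J_i = {j > i}`) and sparse kernels skipping structural zeros are instances, and the
residual bound of Lemma 7.3 holds for every such sweep (triangularity is what makes the sweep an
algorithm; the bound does not use it). PIVOTING: as in the printed proof, the LU theorems are stated
for the permuted matrix `B = PA` (`LURun u B L U`); the final nonsingularity statement carries `P`.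
0-BASED INDICES: row `i : Fin n` of a lower triangular solve subtracts `i` products.

PROVED HERE (0 named facts, 0 sorry; standard axioms):
* kernels — `abs_const_sub_sum_sub_val_le` = Lemma 7.1 / Corollary 7.2 (23) for `b_k = 1` (`u̲ = 0`,
  with the sharp `γ_{k-1}`); the division kernel is `Rump2006.CTree.abs_sub_sum_sub_mul_le` (= (22));
  `BandSum.exists_factors` (indexed rounding factors, for the backward-error form);
* substitution — `SubstSweep.abs_sub_mulVec_le_split` / `…_le` = Lemma 7.3 (`|b - Tx̃| ≤ γ_n |T||x̃|`,
  row-wise, with the split `γ_{n-1}` off-diagonal / `γ_n` diagonal), `UnitSubstSweep.abs_sub_mulVec_le`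
  (unit triangular, `γ_{n-1} ≤ γ_n`), `SubstSweep.exists_backwardError` = Higham Theorem 8.5
  (`(T + ΔT)x̃ = b`, `|ΔT| ≤ γ_n |T|`); `abs_inv_mul_sub_one_le` = Theorem 4.2 (15) and
  `abs_inv_mul_sub_one_le_unit` = (16): `|XT - I| ≤ γ_n |X||T|`;
* LU — `LURun.abs_sub_mul_le` = Theorem 4.1 (14) / Higham Theorem 9.3 (`|B - LU| ≤ γ_n |L||U|`,
  entrywise, with the sharp `γ_{min(i,j)+1}`);
* verification — `abs_mul_mul_sub_one_le` = the chain (13) in entrywise form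
  (`|X_U X_L B - I| ≤ (g₁ + g₂) |X_U||X_L||L||U| + g₃ |X_U||U|` from the three residual bounds with
  constants `g₁, g₂, g₃`; `= 2γ_n …, γ_n …` with those of Theorems 4.1, 4.2),
  `sum_abs_mul_mul_sub_one_le` = Proposition 4.3 (17) (row sums against `e = (1,…,1)ᵀ`),
  `sum_abs_mul_mul_sub_one_le_residual` = the Ogita–Oishi variant (4.8); over `ℝ` with the `ℓ∞`
  operator norm: `linfty_norm_mul_mul_sub_one_le` (`α ≤ (17)`), `isUnit_det_of_lu_verification`
  (`α < 1 ⟹ A` and `PA` nonsingular), and (3)–(4): `linfty_isUnit_det_of_norm_mul_sub_one_lt`,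
  `linfty_norm_inv_le_of_norm_mul_sub_one_le`, `linfty_norm_inv_mulVec_sub_le` (`‖A⁻¹b - x̃‖_∞ ≤
  ‖R(Ax̃ - b)‖_∞ / (1 - α)`).
WHAT IS NOT HERE: the underflow terms (`u̲`, `ε`, `δ_n`), the directed-rounding evaluation of the
bound (17) itself (Algorithms 2.1–3.5: a client evaluates the right-hand sides with `setround`), and
IEEE formats (`u = 2⁻⁵³` is supplied by the client, cf. `Literature.ComputerArithmetic.JeannerodRump2018`).
-/

namespace Literature.ComputerArithmetic.OishiRump2002

open Finset Matrix
open Literature.ComputerArithmetic.Higham2002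
open Literature.ComputerArithmetic.Rump2006

variable {K : Type*} [Field K] [LinearOrder K] [IsStrictOrderedRing K]

/-! ### The kernel without division (Lemma 7.1 / Corollary 7.2 for `b_k = 1`, `u̲ = 0`) -/

section Kernel

variable {u : K}

/-- OISHI–RUMP LEMMA 7.1 / COROLLARY 7.2 (23), case `b_k = 1` ("so that there is no division"), no
underflow: if `ỹ = fl(c - Σ_{i<k} a_i b_i)` is evaluated in floating point, in any order, then
`|c - Σ a_i b_i - ỹ| ≤ γ_{k-1} (Σ |a_i b_i| + |ỹ|)` (the printed (23) has `γ_k`; Lemma 7.1 gives the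
sharper `γ_{k-1}` used here; the `k - 1` products are `e.terms`). [cite: OishiRump2002, Lemma 7.1 and Corollary 7.2 (23)]
[cite: Higham2002ASNA, Lemma 8.4] -/
theorem abs_const_sub_sum_sub_val_le (hu : 0 ≤ u) {e : CTree K} (he : e.WF u)
    (hk : ((e.terms.length : K) + 1) * u < 1) :
    |e.const - e.terms.sum - e.val| ≤
      gamma u e.terms.length * ((e.terms.map (fun z => |z|)).sum + |e.val|) := by
  have hu1 : u < 1 := by nlinarith [Nat.cast_nonneg (α := K) e.terms.length]
  have hk' : (e.terms.length : K) * u < 1 := by nlinarith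
  obtain ⟨Ψ, S, hΨ, hS, hid⟩ := e.master hu hu1 he
  have h1 := hS.abs_sub_sum_le hu hu1 hk'
  have h2 := hΨ.abs_sub_one_le hu hu1 hk'
  calc |e.const - e.terms.sum - e.val| = |(S - e.terms.sum) + e.val * (Ψ - 1)| := by
        rw [show e.const = e.val * Ψ + S by rw [hid]; ring]; ring_nf
    _ ≤ |S - e.terms.sum| + |e.val * (Ψ - 1)| := abs_add_le _ _
    _ ≤ gamma u e.terms.length * (e.terms.map (fun z => |z|)).sum +
          gamma u e.terms.length * |e.val| := by
        apply add_le_add h1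
        rw [abs_mul, mul_comm]
        exact mul_le_mul_of_nonneg_right h2 (abs_nonneg _)
    _ = _ := by ring

omit [Field K] in
/-- `Σ |z_ℓ| ≥ 0`. [cite: OishiRump2002, Corollary 7.2] -/
theorem sum_map_abs_nonneg {R : Type*} [AddCommGroup R] [LinearOrder R] [IsOrderedAddMonoid R]
    (l : List R) : 0 ≤ (l.map (fun z => |z|)).sum :=
  List.sum_nonneg (by
    intro z hz
    rw [List.mem_map] at hz
    obtain ⟨w, _, rfl⟩ := hz
    exact abs_nonneg w)

/-- The printed form of Corollary 7.2 (23) (`γ_k`, `k - 1 =` the number of products), no underflow.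
[cite: OishiRump2002, Corollary 7.2 (23)] -/
theorem abs_const_sub_sum_sub_val_le' (hu : 0 ≤ u) {e : CTree K} (he : e.WF u)
    (hk : ((e.terms.length : K) + 1) * u < 1) :
    |e.const - e.terms.sum - e.val| ≤
      gamma u (e.terms.length + 1) * ((e.terms.map (fun z => |z|)).sum + |e.val|) := by
  refine (abs_const_sub_sum_sub_val_le hu he hk).trans (mul_le_mul_of_nonneg_right ?_
    (add_nonneg (sum_map_abs_nonneg _) (abs_nonneg _)))
  exact gamma_mono hu (Nat.le_succ _) (by push_cast; exact hk)

omit [IsStrictOrderedRing K] in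
/-- Indexed rounding factors: a banded sum over the terms `f j`, `j ∈ l` (a duplicate-free index
list), is `Σ_{j ∈ l} f j · ψ_j` for a FAMILY `ψ : ι → K` of factors in the band — the
`(1 + Θ^{(i)})` of Lemma 7.1 attached to the index `i`. [cite: OishiRump2002, Lemma 7.1 (19)]
[cite: Higham2002ASNA, Lemma 8.4] -/
theorem BandSum.exists_factors {ι : Type*} [DecidableEq ι] {m : ℕ} (f : ι → K) :
    ∀ {l : List ι}, l.Nodup → ∀ {s : K}, BandSum u m (l.map f) s →
      ∃ ψ : ι → K, (∀ j ∈ l, Band u m (ψ j)) ∧ s = (l.map fun j => f j * ψ j).sum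
  | [], _, s, h => by
      have hs : s = 0 := h
      exact ⟨fun _ => 1, fun j hj => absurd hj List.not_mem_nil, by simp [hs]⟩
  | a :: l, hnd, s, h => by
      simp only [List.map_cons, BandSum] at h
      obtain ⟨ψ₀, s', hψ₀, hs', hs⟩ := h
      obtain ⟨hal, hl⟩ := List.nodup_cons.mp hnd
      obtain ⟨ψ, hψ, hs''⟩ := BandSum.exists_factors f hl hs'
      refine ⟨Function.update ψ a ψ₀, ?_, ?_⟩
      · intro j hj
        rcases List.mem_cons.mp hj with rfl | hj
        · rw [Function.update_self]; exact hψ₀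
        · have hja : j ≠ a := fun h => hal (h ▸ hj)
          rw [Function.update_of_ne hja]; exact hψ j hj
      · have hmap : (l.map fun j => f j * Function.update ψ a ψ₀ j) = l.map fun j => f j * ψ j :=
          List.map_congr_left fun j hj => by
            have hja : j ≠ a := fun h => hal (h ▸ hj)
            rw [Function.update_of_ne hja]
        simp only [List.map_cons, List.sum_cons, Function.update_self, hmap]
        rw [hs, hs'']

end Kernel

/-! ### Row bookkeeping for sweeps over an index list -/

section Rows

variable {n : ℕ}

omit [LinearOrder K] [IsStrictOrderedRing K] in
/-- If `l ∌ i` is duplicate-free and `g` vanishes off `{i} ∪ l`, then `Σ_j g j = g i + Σ_{j ∈ l} g j`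
(the row sum of a sweep splits into the diagonal term and the subtracted products).
[cite: OishiRump2002, proof of Lemma 7.3] -/
theorem sum_eq_add_sum_map {i : Fin n} {l : List (Fin n)} (hnd : l.Nodup) (hi : i ∉ l)
    (g : Fin n → K) (hg : ∀ j, j ≠ i → j ∉ l → g j = 0) :
    ∑ j, g j = g i + (l.map g).sum := by
  classical
  have hsub : l.toFinset ⊆ univ.erase i := by
    intro j hj
    rw [List.mem_toFinset] at hj
    exact mem_erase.mpr ⟨fun h => hi (h ▸ hj), mem_univ j⟩
  have h1 : ∑ j ∈ univ.erase i, g j = ∑ j ∈ l.toFinset, g j := by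
    refine (sum_subset hsub fun j hj hjl => ?_).symm
    exact hg j (mem_erase.mp hj).1 (fun h => hjl (List.mem_toFinset.mpr h))
  rw [← add_sum_erase univ g (mem_univ i), h1, List.sum_toFinset g hnd]

omit [Field K] [LinearOrder K] [IsStrictOrderedRing K] in
/-- a duplicate-free index list avoiding `i` has at most `n - 1` entries (a row of a triangular
solve subtracts at most `n - 1` products). [cite: OishiRump2002, proof of Lemma 7.3] -/
theorem length_le_sub_one {i : Fin n} {l : List (Fin n)} (hnd : l.Nodup) (hi : i ∉ l) :
    l.length ≤ n - 1 := by
  classical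
  have hsub : l.toFinset ⊆ univ.erase i := by
    intro j hj
    rw [List.mem_toFinset] at hj
    exact mem_erase.mpr ⟨fun h => hi (h ▸ hj), mem_univ j⟩
  have := card_le_card hsub
  rw [List.toFinset_card_of_nodup hnd, card_erase_of_mem (mem_univ i), card_univ,
    Fintype.card_fin] at this
  exact this

end Rows

/-! ### Substitution sweeps (Lemma 7.3, Theorem 4.2, Higham Theorem 8.5) -/

section Subst

variable {u : K} {n : ℕ}

/-- OISHI–RUMP LEMMA 7.3 / HIGHAM THEOREM 8.5, the object: "the linear system `Tx = b` is solved by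
(backward or forward) substitution, in ANY order of evaluation, with computed solution `x̃`" — typed as
a ROW SWEEP: for every row `i` there is a duplicate-free index list `J_i ∌ i` containing every
`j ≠ i` with `T_ij ≠ 0`, and `x̃_i = fl( s̃ / T_ii )`, `T_ii ≠ 0`, where `s̃` is a floating-point
evaluation (a well-formed `CTree`: any order, blocked, fused operations allowed) of
`b_i - Σ_{j ∈ J_i} T_ij x̃_j`. Forward substitution with lower triangular `T` is the instance
`J_i = {j : j < i}` (printed: `x̃_k = fl((b_k - Σ_{i<k} T_ki x̃_i)/T_kk)`), backward substitution
`J_i = {j : j > i}`; sparse kernels skipping structural zeros are covered too.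
Standard model without underflow. [cite: OishiRump2002, Lemma 7.3] [cite: Higham2002ASNA, Theorem 8.5] -/
structure SubstSweep (u : K) (T : Matrix (Fin n) (Fin n) K) (b x : Fin n → K) : Prop where
  row : ∀ i : Fin n, ∃ (l : List (Fin n)) (e : CTree K), l.Nodup ∧ i ∉ l ∧
    (∀ j, j ≠ i → T i j ≠ 0 → j ∈ l) ∧ e.WF u ∧ e.const = b i ∧
    e.terms.Perm (l.map fun j => T i j * x j) ∧ T i i ≠ 0 ∧
    |x i - e.val / T i i| ≤ u * |e.val / T i i|

/-- The same sweep for UNIT triangular `T` ("for unit triangular `T`", (16), (23): `T_ii = 1`, no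
division): `x̃_i = fl(b_i - Σ_{j ∈ J_i} T_ij x̃_j)` is the value of the evaluation tree itself.
[cite: OishiRump2002, Lemma 7.3 and Theorem 4.2 (16)] -/
structure UnitSubstSweep (u : K) (T : Matrix (Fin n) (Fin n) K) (b x : Fin n → K) : Prop where
  row : ∀ i : Fin n, ∃ (l : List (Fin n)) (e : CTree K), l.Nodup ∧ i ∉ l ∧
    (∀ j, j ≠ i → T i j ≠ 0 → j ∈ l) ∧ e.WF u ∧ e.const = b i ∧
    e.terms.Perm (l.map fun j => T i j * x j) ∧ T i i = 1 ∧ x i = e.val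

omit [LinearOrder K] [IsStrictOrderedRing K] in
/-- `(T x̃)_i = T_ii x̃_i + Σ_{j ∈ J_i} T_ij x̃_j` for a sweep row. [cite: OishiRump2002, proof of Lemma 7.3] -/
theorem mulVec_eq_add_sum_map {T : Matrix (Fin n) (Fin n) K} {x : Fin n → K} {i : Fin n}
    {l : List (Fin n)} (hnd : l.Nodup) (hi : i ∉ l) (hcov : ∀ j, j ≠ i → T i j ≠ 0 → j ∈ l) :
    (T *ᵥ x) i = T i i * x i + (l.map fun j => T i j * x j).sum := by
  rw [show (T *ᵥ x) i = ∑ j, T i j * x j from rfl]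
  refine sum_eq_add_sum_map hnd hi (fun j => T i j * x j) fun j hji hjl => ?_
  have : T i j = 0 := by
    by_contra h
    exact hjl (hcov j hji h)
  rw [this, zero_mul]

/-- `Σ_j |T_ij| |x̃_j| = |T_ii| |x̃_i| + Σ_{j ∈ J_i} |T_ij x̃_j|` for a sweep row. [cite: OishiRump2002, proof of Lemma 7.3] -/
theorem sum_abs_eq_add_sum_map {T : Matrix (Fin n) (Fin n) K} {x : Fin n → K} {i : Fin n}
    {l : List (Fin n)} (hnd : l.Nodup) (hi : i ∉ l) (hcov : ∀ j, j ≠ i → T i j ≠ 0 → j ∈ l) :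
    ∑ j, |T i j| * |x j| = |T i i| * |x i| + ((l.map fun j => T i j * x j).map (fun z => |z|)).sum := by
  rw [List.map_map]
  have h := sum_eq_add_sum_map hnd hi (fun j => |T i j| * |x j|) fun j hji hjl => by
    have : T i j = 0 := by
      by_contra h
      exact hjl (hcov j hji h)
    rw [this, abs_zero, zero_mul]
  rw [h]
  congr 1
  refine congrArg List.sum (List.map_congr_left fun j _ => ?_)
  simp [Function.comp, abs_mul]

namespace SubstSweep

variable {T : Matrix (Fin n) (Fin n) K} {b x : Fin n → K}

/-- OISHI–RUMP LEMMA 7.3, no underflow, row-wise with the sharp split constants of Lemma 7.1: for a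
substitution sweep in any order and `nu < 1`,
`|b_i - (T x̃)_i| ≤ γ_{n-1} Σ_{j ≠ i} |T_ij| |x̃_j| + γ_n |T_ii| |x̃_i|`.
[cite: OishiRump2002, Lemma 7.3 and Corollary 7.2 (22)] [cite: Higham2002ASNA, Lemma 8.4] -/
theorem abs_sub_mulVec_le_split (hu : 0 ≤ u) (hn : (n : K) * u < 1) (h : SubstSweep u T b x)
    (i : Fin n) :
    |b i - (T *ᵥ x) i| ≤
      gamma u (n - 1) * (∑ j ∈ univ.erase i, |T i j| * |x j|) + gamma u n * (|T i i| * |x i|) := by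
  obtain ⟨l, e, hnd, hi, hcov, he, hc, hperm, hTii, hy⟩ := h.row i
  have hlen : e.terms.length = l.length := by rw [hperm.length_eq, List.length_map]
  have hl := length_le_sub_one hnd hi
  have hn1 : 1 ≤ n := by have := i.isLt; omega
  have hcast : ((n - 1 : ℕ) : K) + 1 = n := by
    rw [Nat.cast_sub hn1, Nat.cast_one]; ring
  have hk : ((e.terms.length : K) + 1) * u < 1 := by
    have : (e.terms.length : K) + 1 ≤ n := by
      rw [← hcast, hlen]; exact_mod_cast Nat.add_le_add_right hl 1
    nlinarith
  have hn' : ((n - 1 : ℕ) : K) * u < 1 := by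
    have : ((n - 1 : ℕ) : K) ≤ n := by exact_mod_cast Nat.sub_le n 1
    nlinarith
  have main := CTree.abs_sub_sum_sub_mul_le hu he hTii hy hk
  -- rewrite the kernel's sums into the row sums
  have hsum : e.terms.sum = (l.map fun j => T i j * x j).sum := hperm.sum_eq
  have habs : (e.terms.map (fun z => |z|)).sum =
      ((l.map fun j => T i j * x j).map (fun z => |z|)).sum := (hperm.map _).sum_eq
  have hrow := mulVec_eq_add_sum_map (T := T) (x := x) hnd hi hcov
  have hrowabs := sum_abs_eq_add_sum_map (T := T) (x := x) hnd hi hcov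
  have herase : ∑ j ∈ univ.erase i, |T i j| * |x j| =
      ((l.map fun j => T i j * x j).map (fun z => |z|)).sum := by
    have := add_sum_erase univ (fun j => |T i j| * |x j|) (mem_univ i)
    rw [hrowabs] at this
    linarith
  rw [hc, hsum, habs, sub_right_comm] at main
  rw [hrow, herase, ← sub_sub]
  refine main.trans (add_le_add ?_ ?_)
  · exact mul_le_mul_of_nonneg_right (gamma_mono hu (by omega) hn') (sum_map_abs_nonneg _)
  · rw [abs_mul]
    exact mul_le_mul_of_nonneg_right (gamma_mono hu (by omega) hn) (by positivity)

/-- OISHI–RUMP LEMMA 7.3, no underflow (= HIGHAM THEOREM 8.5 in residual form): for a substitution sweep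
in any order and `nu < 1`, `|b - T x̃| ≤ γ_n |T| |x̃|`, i.e. `|b_i - (T x̃)_i| ≤ γ_n Σ_j |T_ij| |x̃_j|`
for every row `i`. [cite: OishiRump2002, Lemma 7.3] [cite: OgitaOishi2009, (4.6)] [cite: Higham2002ASNA, Theorem 8.5] -/
theorem abs_sub_mulVec_le (hu : 0 ≤ u) (hn : (n : K) * u < 1) (h : SubstSweep u T b x)
    (i : Fin n) : |b i - (T *ᵥ x) i| ≤ gamma u n * ∑ j, |T i j| * |x j| := by
  have hn' : ((n - 1 : ℕ) : K) * u < 1 := by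
    have : ((n - 1 : ℕ) : K) ≤ n := by exact_mod_cast Nat.sub_le n 1
    nlinarith
  have hsplit : ∑ j, |T i j| * |x j| = |T i i| * |x i| + ∑ j ∈ univ.erase i, |T i j| * |x j| :=
    (add_sum_erase univ (fun j => |T i j| * |x j|) (mem_univ i)).symm
  refine (h.abs_sub_mulVec_le_split hu hn i).trans ?_
  rw [hsplit, mul_add, add_comm (gamma u n * (|T i i| * |x i|))]
  exact add_le_add (mul_le_mul_of_nonneg_right (gamma_mono hu (Nat.sub_le n 1) hn)
    (sum_nonneg fun j _ => by positivity)) le_rfl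

/-- HIGHAM THEOREM 8.5 (backward-error form): for a substitution sweep in any order and `nu < 1`
there is `ΔT` with `(T + ΔT) x̃ = b` and `|ΔT| ≤ γ_n |T|` entrywise (in fact `γ_{n-1}` off the
diagonal); `ΔT` vanishes wherever `T` does. [cite: Higham2002ASNA, Theorem 8.5] [cite: OishiRump2002, Lemma 7.1 (19)] -/
theorem exists_backwardError (hu : 0 ≤ u) (hn : (n : K) * u < 1) (h : SubstSweep u T b x) :
    ∃ ΔT : Matrix (Fin n) (Fin n) K, (T + ΔT) *ᵥ x = b ∧ ∀ i j, |ΔT i j| ≤ gamma u n * |T i j| := by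
  classical
  have hn' : ((n - 1 : ℕ) : K) * u < 1 := by
    have : ((n - 1 : ℕ) : K) ≤ n := by exact_mod_cast Nat.sub_le n 1
    nlinarith
  -- per row: the factor identity with indexed factors, already converted to `γ` bounds
  have key : ∀ i : Fin n, ∃ (l : List (Fin n)) (Ψ : K) (ψ : Fin n → K), l.Nodup ∧ i ∉ l ∧
      (∀ j, j ≠ i → T i j ≠ 0 → j ∈ l) ∧ |Ψ - 1| ≤ gamma u n ∧
      (∀ j ∈ l, |ψ j - 1| ≤ gamma u n) ∧
      T i i * x i * Ψ + (l.map fun j => T i j * x j * ψ j).sum = b i := by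
    intro i
    obtain ⟨l, e, hnd, hi, hcov, he, hc, hperm, hTii, hy⟩ := h.row i
    have hlen : e.terms.length = l.length := by rw [hperm.length_eq, List.length_map]
    have hl := length_le_sub_one hnd hi
    have hn1 : 1 ≤ n := by have := i.isLt; omega
    have hu1 : u < 1 := by
      have : (1 : K) ≤ n := by exact_mod_cast hn1
      nlinarith
    have hm1 : ((l.length : K) + 1) * u < 1 := by
      have : (l.length : K) + 1 ≤ n := by
        have h' : l.length + 1 ≤ n := by omega
        exact_mod_cast h'
      nlinarith
    have hm : (l.length : K) * u < 1 := by nlinarith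
    obtain ⟨Ψ, S, hΨ, hS, hid⟩ := CTree.div_factor hu hu1 he hTii hy
    rw [hlen] at hΨ hS
    obtain ⟨ψ, hψ, hS'⟩ := BandSum.exists_factors (fun j => T i j * x j) hnd (hS.perm hperm)
    refine ⟨l, Ψ, ψ, hnd, hi, hcov, ?_, ?_, ?_⟩
    · exact (hΨ.abs_sub_one_le hu hu1 (by push_cast; exact hm1)).trans
        (gamma_mono hu (by omega) hn)
    · intro j hj
      exact ((hψ j hj).abs_sub_one_le hu hu1 hm).trans (gamma_mono hu (by omega) hn)
    · rw [hid, hc, hS']; ring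
  choose l Ψ ψ hnd hi hcov hΨ hψ hid using key
  refine ⟨Matrix.of fun i j => if j = i then T i i * (Ψ i - 1)
    else if j ∈ l i then T i j * (ψ i j - 1) else 0, ?_, ?_⟩
  · ext i
    rw [show ((T + Matrix.of fun i j => if j = i then T i i * (Ψ i - 1)
        else if j ∈ l i then T i j * (ψ i j - 1) else 0) *ᵥ x) i =
        ∑ j, (T i j + (if j = i then T i i * (Ψ i - 1)
          else if j ∈ l i then T i j * (ψ i j - 1) else 0)) * x j from rfl]
    have hg := sum_eq_add_sum_map (hnd i) (hi i)
      (fun j => (T i j + (if j = i then T i i * (Ψ i - 1)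
        else if j ∈ l i then T i j * (ψ i j - 1) else 0)) * x j)
      (fun j hji hjl => by
        have hT : T i j = 0 := by
          by_contra hT
          exact hjl (hcov i j hji hT)
        rw [hT, if_neg hji, if_neg hjl, zero_add, zero_mul])
    rw [hg, ← hid i]
    congr 1
    · rw [if_pos rfl]; ring
    · refine congrArg List.sum (List.map_congr_left fun j hj => ?_)
      have hji : j ≠ i := fun h' => hi i (h' ▸ hj)
      rw [if_neg hji, if_pos hj]; ring
  · intro i j
    simp only [Matrix.of_apply]
    split_ifs with hji hjl
    · rw [hji, abs_mul, mul_comm]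
      exact mul_le_mul_of_nonneg_right (hΨ i) (abs_nonneg _)
    · rw [abs_mul, mul_comm]
      exact mul_le_mul_of_nonneg_right (hψ i j hjl) (abs_nonneg _)
    · rw [abs_zero]
      exact mul_nonneg (gamma_nonneg hu hn) (abs_nonneg _)

end SubstSweep

namespace UnitSubstSweep

variable {T : Matrix (Fin n) (Fin n) K} {b x : Fin n → K}

/-- OISHI–RUMP LEMMA 7.3 for UNIT triangular `T`, no underflow, with the sharp constant of Lemma 7.1
(`b_k = 1`: `γ_{k-1}`): `|b_i - (T x̃)_i| ≤ γ_{n-1} Σ_j |T_ij| |x̃_j|`. [cite: OishiRump2002, Lemma 7.3 and Lemma 7.1] -/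
theorem abs_sub_mulVec_le_pred (hu : 0 ≤ u) (hn : (n : K) * u < 1) (h : UnitSubstSweep u T b x)
    (i : Fin n) : |b i - (T *ᵥ x) i| ≤ gamma u (n - 1) * ∑ j, |T i j| * |x j| := by
  obtain ⟨l, e, hnd, hi, hcov, he, hc, hperm, hTii, hxi⟩ := h.row i
  have hlen : e.terms.length = l.length := by rw [hperm.length_eq, List.length_map]
  have hl := length_le_sub_one hnd hi
  have hn1 : 1 ≤ n := by have := i.isLt; omega
  have hcast : ((n - 1 : ℕ) : K) + 1 = n := by
    rw [Nat.cast_sub hn1, Nat.cast_one]; ring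
  have hk : ((e.terms.length : K) + 1) * u < 1 := by
    have : (e.terms.length : K) + 1 ≤ n := by
      rw [← hcast, hlen]; exact_mod_cast Nat.add_le_add_right hl 1
    nlinarith
  have hn' : ((n - 1 : ℕ) : K) * u < 1 := by
    have : ((n - 1 : ℕ) : K) ≤ n := by exact_mod_cast Nat.sub_le n 1
    nlinarith
  have main := abs_const_sub_sum_sub_val_le hu he hk
  have hsum : e.terms.sum = (l.map fun j => T i j * x j).sum := hperm.sum_eq
  have habs : (e.terms.map (fun z => |z|)).sum =
      ((l.map fun j => T i j * x j).map (fun z => |z|)).sum := (hperm.map _).sum_eq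
  have hrow := mulVec_eq_add_sum_map (T := T) (x := x) hnd hi hcov
  have hrowabs := sum_abs_eq_add_sum_map (T := T) (x := x) hnd hi hcov
  rw [hc, hsum, habs, ← hxi, sub_right_comm] at main
  rw [hrow, hrowabs, hTii, one_mul, abs_one, one_mul, ← sub_sub, add_comm (|x i|)]
  exact main.trans (mul_le_mul_of_nonneg_right (gamma_mono hu (by omega) hn')
    (add_nonneg (sum_map_abs_nonneg _) (abs_nonneg _)))

/-- OISHI–RUMP LEMMA 7.3 for unit triangular `T`, the printed constant (no underflow):
`|b - T x̃| ≤ γ_n |T| |x̃|`. [cite: OishiRump2002, Lemma 7.3] -/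
theorem abs_sub_mulVec_le (hu : 0 ≤ u) (hn : (n : K) * u < 1) (h : UnitSubstSweep u T b x)
    (i : Fin n) : |b i - (T *ᵥ x) i| ≤ gamma u n * ∑ j, |T i j| * |x j| :=
  (h.abs_sub_mulVec_le_pred hu hn i).trans
    (mul_le_mul_of_nonneg_right (gamma_mono hu (Nat.sub_le n 1) hn) (by positivity))

end UnitSubstSweep

/-- OISHI–RUMP THEOREM 4.2 (15), no underflow (= OGITA–OISHI (4.6)): if the rows `x_i` of an
approximate inverse `X` of `T` are computed by substitution, in any order, from the `n` systems
`Tᵀ x_i = e_i`, then `|XT - I| ≤ γ_n |X| |T|` entrywise. [cite: OishiRump2002, Theorem 4.2 (15)]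
[cite: OgitaOishi2009, (4.6)] -/
theorem abs_inv_mul_sub_one_le (hu : 0 ≤ u) (hn : (n : K) * u < 1) {T X : Matrix (Fin n) (Fin n) K}
    (h : ∀ i, SubstSweep u Tᵀ (Pi.single i 1) (X i)) (i j : Fin n) :
    |(X * T - 1) i j| ≤ gamma u n * ∑ k, |X i k| * |T k j| := by
  have h1 := (h i).abs_sub_mulVec_le hu hn j
  have hmv : (Tᵀ *ᵥ X i) j = (X * T) i j := by
    rw [show (Tᵀ *ᵥ X i) j = ∑ k, Tᵀ j k * X i k from rfl, Matrix.mul_apply]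
    exact sum_congr rfl fun k _ => by rw [transpose_apply, mul_comm]
  have hone : (Pi.single i 1 : Fin n → K) j = (1 : Matrix (Fin n) (Fin n) K) i j := by
    rw [Matrix.one_eq_pi_single]
  rw [Matrix.sub_apply, abs_sub_comm, ← hone, ← hmv]
  refine h1.trans (le_of_eq ?_)
  congr 1
  exact sum_congr rfl fun k _ => by rw [transpose_apply, mul_comm]

/-- OISHI–RUMP THEOREM 4.2 (16), no underflow: for UNIT triangular `T` and rows computed without
division, `|XT - I| ≤ γ_{n-1} |X| |T| ≤ γ_n |X| |T|` entrywise. [cite: OishiRump2002, Theorem 4.2 (16)] -/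
theorem abs_inv_mul_sub_one_le_unit (hu : 0 ≤ u) (hn : (n : K) * u < 1)
    {T X : Matrix (Fin n) (Fin n) K} (h : ∀ i, UnitSubstSweep u Tᵀ (Pi.single i 1) (X i))
    (i j : Fin n) : |(X * T - 1) i j| ≤ gamma u n * ∑ k, |X i k| * |T k j| := by
  have h1 := (h i).abs_sub_mulVec_le hu hn j
  have hmv : (Tᵀ *ᵥ X i) j = (X * T) i j := by
    rw [show (Tᵀ *ᵥ X i) j = ∑ k, Tᵀ j k * X i k from rfl, Matrix.mul_apply]
    exact sum_congr rfl fun k _ => by rw [transpose_apply, mul_comm]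
  have hone : (Pi.single i 1 : Fin n → K) j = (1 : Matrix (Fin n) (Fin n) K) i j := by
    rw [Matrix.one_eq_pi_single]
  rw [Matrix.sub_apply, abs_sub_comm, ← hone, ← hmv]
  refine h1.trans (le_of_eq ?_)
  congr 1
  exact sum_congr rfl fun k _ => by rw [transpose_apply, mul_comm]

end Subst

/-! ### Gaussian elimination in any order (Theorem 4.1 / Higham Theorem 9.3) -/

section LU

variable {u : K} {n : ℕ}

/-- The products `L_im U_mj`, `m < p` (0-based), subtracted from `B_ij` in Doolittle's formulas
(`p = i` for the `U`-row entries `i ≤ j`, `p = j` for the `L`-column entries `i > j`).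
[cite: OishiRump2002, §4 (Doolittle's method)] [cite: Higham2002ASNA, Algorithm 9.2] -/
def luProds (L U : Matrix (Fin n) (Fin n) K) (i j p : Fin n) : List K :=
  List.ofFn fun m : Fin p.val => L i (Fin.castLE p.isLt.le m) * U (Fin.castLE p.isLt.le m) j

/-- OISHI–RUMP THEOREM 4.1 / HIGHAM THEOREM 9.3, the object: "`L, U` are computed by some variant of
Gaussian elimination" applied to `B` (`= PA`: "Gaussian elimination with pivoting is equivalent to
Gaussian elimination without pivoting applied to a permuted matrix"), i.e. Doolittle's formulas
evaluated in ANY order: `L` unit lower triangular, `U` upper triangular,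
`U_ij = fl(B_ij - Σ_{m<i} L_im U_mj)` (`i ≤ j`, no division: the computed entry is the value of a
well-formed `CTree`), `L_ij = fl( fl(B_ij - Σ_{m<j} L_im U_mj) / U_jj )` with `U_jj ≠ 0` (`i > j`).
Standard model without underflow; 0-based indices. [cite: OishiRump2002, Theorem 4.1 and §4]
[cite: Higham2002ASNA, Theorem 9.3 and Algorithm 9.2] -/
structure LURun (u : K) (B L U : Matrix (Fin n) (Fin n) K) : Prop where
  unit_diag : ∀ i : Fin n, L i i = 1
  lower : ∀ i j : Fin n, i < j → L i j = 0
  upper : ∀ i j : Fin n, j < i → U i j = 0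
  urow : ∀ i j : Fin n, i ≤ j → ∃ e : CTree K, e.WF u ∧ e.const = B i j ∧
    e.terms.Perm (luProds L U i j i) ∧ U i j = e.val
  lcol : ∀ i j : Fin n, j < i → ∃ e : CTree K, e.WF u ∧ e.const = B i j ∧
    e.terms.Perm (luProds L U i j j) ∧ U j j ≠ 0 ∧ |L i j - e.val / U j j| ≤ u * |e.val / U j j|

namespace LURun

variable {B L U : Matrix (Fin n) (Fin n) K}

omit [LinearOrder K] [IsStrictOrderedRing K] in
/-- `p` products are subtracted in stage `(i, j)` with `p = min(i, j)`. [cite: OishiRump2002, §4] -/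
theorem length_luProds (L U : Matrix (Fin n) (Fin n) K) (i j p : Fin n) :
    (luProds L U i j p).length = p.val := by
  simp [luProds]

/-- `U`-part, `i ≤ j` (no division; `i` products): the sharp bound of Lemma 7.1 (`b_k = 1`),
`|B_ij - (LU)_ij| ≤ γ_i Σ_m |L_im| |U_mj|` (0-based `i`). [cite: OishiRump2002, Theorem 4.1 and Lemma 7.1]
[cite: Higham2002ASNA, Theorem 9.3] -/
theorem abs_sub_mul_le_of_le (hu : 0 ≤ u) (hn : (n : K) * u < 1) (h : LURun u B L U)
    {i j : Fin n} (hij : i ≤ j) :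
    |B i j - (L * U) i j| ≤ gamma u i.val * ∑ m, |L i m| * |U m j| := by
  obtain ⟨e, he, hc, hperm, hval⟩ := h.urow i j hij
  have hlen : e.terms.length = i.val := by rw [hperm.length_eq, length_luProds]
  have hk : ((e.terms.length : K) + 1) * u < 1 := by
    have : (e.terms.length : K) + 1 ≤ n := by
      rw [hlen]; exact_mod_cast (by have := i.isLt; omega : i.val + 1 ≤ n)
    nlinarith
  have main := abs_const_sub_sum_sub_val_le hu he hk
  have hsum : e.terms.sum = ∑ m : Fin i.val,
      L i (Fin.castLE i.isLt.le m) * U (Fin.castLE i.isLt.le m) j := by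
    rw [hperm.sum_eq, luProds, List.sum_ofFn]
  have habs : (e.terms.map (fun z => |z|)).sum = ∑ m : Fin i.val,
      |L i (Fin.castLE i.isLt.le m)| * |U (Fin.castLE i.isLt.le m) j| := by
    rw [(hperm.map _).sum_eq, luProds, List.map_ofFn, List.sum_ofFn]
    exact sum_congr rfl fun m _ => abs_mul _ _
  have hLU : (L * U) i j = (∑ m : Fin i.val,
      L i (Fin.castLE i.isLt.le m) * U (Fin.castLE i.isLt.le m) j) + U i j := by
    rw [Matrix.mul_apply, sum_eq_sum_castLE_add (fun m => L i m * U m j) i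
      (fun m hm => by rw [h.lower i m hm, zero_mul])]
    simp only [h.unit_diag i, one_mul]
  have hLUabs : ∑ m, |L i m| * |U m j| = (∑ m : Fin i.val,
      |L i (Fin.castLE i.isLt.le m)| * |U (Fin.castLE i.isLt.le m) j|) + |U i j| := by
    rw [sum_eq_sum_castLE_add (fun m => |L i m| * |U m j|) i
      (fun m hm => by rw [h.lower i m hm, abs_zero, zero_mul])]
    simp only [h.unit_diag i, abs_one, one_mul]
  rw [hlen, hc, hsum, habs, ← hval] at main
  rw [hLU, hLUabs, ← sub_sub]
  exact main

/-- `L`-part, `j < i` (`j` products and one division): the sharp two-constant bound of Lemma 7.1 /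
Rump's (2.3), `|B_ij - (LU)_ij| ≤ γ_j Σ_{m<j} |L_im U_mj| + γ_{j+1} |L_ij U_jj| ≤ γ_{j+1} Σ_m |L_im| |U_mj|`
(0-based `j`). [cite: OishiRump2002, Theorem 4.1 and Corollary 7.2 (22)] [cite: Higham2002ASNA, Theorem 9.3] -/
theorem abs_sub_mul_le_of_lt (hu : 0 ≤ u) (hn : (n : K) * u < 1) (h : LURun u B L U)
    {i j : Fin n} (hji : j < i) :
    |B i j - (L * U) i j| ≤ gamma u (j.val + 1) * ∑ m, |L i m| * |U m j| := by
  obtain ⟨e, he, hc, hperm, hUjj, hy⟩ := h.lcol i j hji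
  have hlen : e.terms.length = j.val := by rw [hperm.length_eq, length_luProds]
  have hj1 : ((j.val : K) + 1) * u < 1 := by
    have : (j.val : K) + 1 ≤ n := by
      exact_mod_cast (by have := i.isLt; have := Fin.lt_def.mp hji; omega : j.val + 1 ≤ n)
    nlinarith
  have main := CTree.abs_sub_sum_sub_mul_le hu he hUjj hy (by rw [hlen]; exact hj1)
  have hsum : e.terms.sum = ∑ m : Fin j.val,
      L i (Fin.castLE j.isLt.le m) * U (Fin.castLE j.isLt.le m) j := by
    rw [hperm.sum_eq, luProds, List.sum_ofFn]
  have habs : (e.terms.map (fun z => |z|)).sum = ∑ m : Fin j.val,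
      |L i (Fin.castLE j.isLt.le m)| * |U (Fin.castLE j.isLt.le m) j| := by
    rw [(hperm.map _).sum_eq, luProds, List.map_ofFn, List.sum_ofFn]
    exact sum_congr rfl fun m _ => abs_mul _ _
  rw [hlen, hc, hsum, habs] at main
  have hLU : (L * U) i j = (∑ m : Fin j.val,
      L i (Fin.castLE j.isLt.le m) * U (Fin.castLE j.isLt.le m) j) + L i j * U j j := by
    rw [Matrix.mul_apply, sum_eq_sum_castLE_add (fun m => L i m * U m j) j
      (fun m hm => by rw [h.upper m j hm, mul_zero])]
  have hLUabs : ∑ m, |L i m| * |U m j| = (∑ m : Fin j.val,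
      |L i (Fin.castLE j.isLt.le m)| * |U (Fin.castLE j.isLt.le m) j|) + |L i j| * |U j j| := by
    rw [sum_eq_sum_castLE_add (fun m => |L i m| * |U m j|) j
      (fun m hm => by rw [h.upper m j hm, abs_zero, mul_zero])]
  rw [hLU, hLUabs, ← sub_sub, mul_comm (L i j) (U j j), mul_add]
  have hg : gamma u j.val ≤ gamma u (j.val + 1) :=
    gamma_mono hu (Nat.le_succ _) (by push_cast; exact hj1)
  refine main.trans (add_le_add ?_ ?_)
  · exact mul_le_mul_of_nonneg_right hg (sum_nonneg fun m _ => by positivity)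
  · rw [abs_mul, mul_comm (|U j j|)]

/-- OISHI–RUMP THEOREM 4.1 (14), no underflow, entrywise with the sharp constant: if `L, U` are
computed from `B` by any variant of Gaussian elimination (any order of evaluation) and `nu < 1`, then
`|B_ij - (LU)_ij| ≤ γ_{min(i,j)+1} (|L| |U|)_ij` (0-based). [cite: OishiRump2002, Theorem 4.1 (14)]
[cite: Higham2002ASNA, Theorem 9.3] -/
theorem abs_sub_mul_le_min (hu : 0 ≤ u) (hn : (n : K) * u < 1) (h : LURun u B L U) (i j : Fin n) :
    |B i j - (L * U) i j| ≤ gamma u (min i.val j.val + 1) * ∑ m, |L i m| * |U m j| := by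
  rcases le_or_gt i j with hij | hji
  · rw [min_eq_left (Fin.le_def.mp hij)]
    have hi1 : ((i.val : K) + 1) * u < 1 := by
      have : (i.val : K) + 1 ≤ n := by exact_mod_cast (by have := i.isLt; omega : i.val + 1 ≤ n)
      nlinarith
    exact (h.abs_sub_mul_le_of_le hu hn hij).trans (mul_le_mul_of_nonneg_right
      (gamma_mono hu (Nat.le_succ _) (by push_cast; exact hi1)) (sum_nonneg fun m _ => by positivity))
  · rw [min_eq_right (le_of_lt (Fin.lt_def.mp hji))]
    exact h.abs_sub_mul_le_of_lt hu hn hji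

/-- OISHI–RUMP THEOREM 4.1 (14) = HIGHAM THEOREM 9.3 = OGITA–OISHI (4.5), no underflow, the printed
uniform constant: `|B - LU| ≤ γ_n |L| |U|` entrywise (`B = PA`). [cite: OishiRump2002, Theorem 4.1 (14)]
[cite: Higham2002ASNA, Theorem 9.3] [cite: OgitaOishi2009, (4.5)] -/
theorem abs_sub_mul_le (hu : 0 ≤ u) (hn : (n : K) * u < 1) (h : LURun u B L U) (i j : Fin n) :
    |B i j - (L * U) i j| ≤ gamma u n * ∑ m, |L i m| * |U m j| := by
  refine (h.abs_sub_mul_le_min hu hn i j).trans (mul_le_mul_of_nonneg_right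
    (gamma_mono hu ?_ hn) (sum_nonneg fun m _ => by positivity))
  have := i.isLt; have := j.isLt
  omega

end LURun

end LU

/-! ### The verification chain (13) and Proposition 4.3 (exact arithmetic over an ordered field) -/

section Chain

variable {n : ℕ}

omit [Field K] [LinearOrder K] [IsStrictOrderedRing K] in
/-- the algebra behind (13): `X_U X_L B - I = X_U X_L (B - LU) + X_U (X_L L - I) U + (X_U U - I)`.
[cite: OishiRump2002, §4 (13)] -/
theorem mul_mul_sub_one_eq {R : Type*} [Ring R] (B L U XL XU : Matrix (Fin n) (Fin n) R) :
    XU * XL * B - 1 = XU * XL * (B - L * U) + XU * (XL * L - 1) * U + (XU * U - 1) := by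
  simp only [Matrix.mul_sub, Matrix.sub_mul, Matrix.mul_one, Matrix.mul_assoc]
  abel

/-- `|(M N)_ij| ≤ (|M| |N|)_ij`. [cite: OishiRump2002, §4 (13)] -/
theorem abs_mul_apply_le (M N : Matrix (Fin n) (Fin n) K) (i j : Fin n) :
    |(M * N) i j| ≤ (M.map (fun z => |z|) * N.map (fun z => |z|)) i j := by
  rw [Matrix.mul_apply, Matrix.mul_apply]
  refine (abs_sum_le_sum_abs _ _).trans (le_of_eq (sum_congr rfl fun k _ => ?_))
  rw [abs_mul, Matrix.map_apply, Matrix.map_apply]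

/-- monotonicity of `|M| · (·)` in an entrywise bound: `|E| ≤ F ⟹ (|M| |E|)_ij ≤ (|M| F)_ij`.
[cite: OishiRump2002, §4 (13)] -/
theorem map_abs_mul_le_of_abs_le {M E F : Matrix (Fin n) (Fin n) K} (hEF : ∀ i j, |E i j| ≤ F i j)
    (i j : Fin n) : (M.map (fun z => |z|) * E.map (fun z => |z|)) i j ≤ (M.map (fun z => |z|) * F) i j := by
  rw [Matrix.mul_apply, Matrix.mul_apply]
  exact sum_le_sum fun k _ => by
    rw [Matrix.map_apply, Matrix.map_apply]
    exact mul_le_mul_of_nonneg_left (hEF k j) (abs_nonneg _)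

/-- … and on the right: `|E| ≤ F ⟹ (|E| |N|)_ij ≤ (F |N|)_ij`. [cite: OishiRump2002, §4 (13)] -/
theorem mul_map_abs_le_of_abs_le {N E F : Matrix (Fin n) (Fin n) K} (hEF : ∀ i j, |E i j| ≤ F i j)
    (i j : Fin n) : (E.map (fun z => |z|) * N.map (fun z => |z|)) i j ≤ (F * N.map (fun z => |z|)) i j := by
  rw [Matrix.mul_apply, Matrix.mul_apply]
  exact sum_le_sum fun k _ => by
    rw [Matrix.map_apply, Matrix.map_apply]
    exact mul_le_mul_of_nonneg_right (hEF i k) (abs_nonneg _)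

/-- entries of a product with a nonnegative left factor are monotone in the right factor.
[cite: OishiRump2002, §4 (13)] -/
theorem mul_apply_mono_right {P E F : Matrix (Fin n) (Fin n) K}
    (hP : ∀ i j, 0 ≤ P i j) (hEF : ∀ i j, E i j ≤ F i j) (i j : Fin n) : (P * E) i j ≤ (P * F) i j := by
  rw [Matrix.mul_apply, Matrix.mul_apply]
  exact sum_le_sum fun k _ => mul_le_mul_of_nonneg_left (hEF k j) (hP i k)

/-- THE CHAIN (13) WITH THE THREE A-PRIORI BOUNDS INSERTED, entrywise and in exact arithmetic: if
`|B - LU| ≤ g₁ |L||U|`, `|X_L L - I| ≤ g₂ |X_L||L|`, `|X_U U - I| ≤ g₃ |X_U||U|` (entrywise, any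
`g₁ g₂ g₃`, e.g. `γ_n` from Theorems 4.1, 4.2), then
`|X_U X_L B - I| ≤ (g₁ + g₂) |X_U||X_L||L||U| + g₃ |X_U||U|` entrywise — the `u̲ = 0` content of the
display before Proposition 4.3 (and of the Oishi–Rump chain on p. 179 of [OgitaOishi2009]).
[cite: OishiRump2002, §4 (13)–(17)] [cite: OgitaOishi2009, (4.7)] -/
theorem abs_mul_mul_sub_one_le {B L U XL XU : Matrix (Fin n) (Fin n) K} {g₁ g₂ g₃ : K}
    (hB : ∀ i j, |(B - L * U) i j| ≤ g₁ * (L.map (fun z => |z|) * U.map (fun z => |z|)) i j)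
    (hL : ∀ i j, |(XL * L - 1) i j| ≤ g₂ * (XL.map (fun z => |z|) * L.map (fun z => |z|)) i j)
    (hU : ∀ i j, |(XU * U - 1) i j| ≤ g₃ * (XU.map (fun z => |z|) * U.map (fun z => |z|)) i j)
    (i j : Fin n) :
    |(XU * XL * B - 1) i j| ≤
      (g₁ + g₂) * (XU.map (fun z => |z|) * XL.map (fun z => |z|) * L.map (fun z => |z|) *
        U.map (fun z => |z|)) i j + g₃ * (XU.map (fun z => |z|) * U.map (fun z => |z|)) i j := by
  set aXU := XU.map (fun z => |z|) with haXU
  set aXL := XL.map (fun z => |z|) with haXL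
  set aL := L.map (fun z => |z|) with haL
  set aU := U.map (fun z => |z|) with haU
  have hPXU : ∀ i j, 0 ≤ aXU i j := fun i j => by rw [haXU, Matrix.map_apply]; exact abs_nonneg _
  have hPXUXL : ∀ i j, 0 ≤ (aXU * aXL) i j := fun i j => by
    rw [Matrix.mul_apply]
    exact sum_nonneg fun k _ => by
      rw [haXU, haXL, Matrix.map_apply, Matrix.map_apply]; positivity
  -- term 1: |X_U X_L (B - LU)| ≤ |X_U||X_L| |B - LU| ≤ g₁ |X_U||X_L||L||U|
  have t1 : |(XU * XL * (B - L * U)) i j| ≤ g₁ * (aXU * aXL * aL * aU) i j := by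
    have s1 := abs_mul_apply_le (XU * XL) (B - L * U) i j
    have s2 : ((XU * XL).map (fun z => |z|) * (B - L * U).map (fun z => |z|)) i j ≤
        (aXU * aXL * (B - L * U).map (fun z => |z|)) i j :=
      mul_map_abs_le_of_abs_le (fun i j => abs_mul_apply_le XU XL i j) i j
    have s3 : (aXU * aXL * (B - L * U).map (fun z => |z|)) i j ≤
        (aXU * aXL * (g₁ • (aL * aU))) i j :=
      mul_apply_mono_right hPXUXL (fun k l => by
        rw [Matrix.map_apply, Matrix.smul_apply, smul_eq_mul]; exact hB k l) i j
    rw [Matrix.mul_smul, Matrix.smul_apply, smul_eq_mul, ← Matrix.mul_assoc] at s3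
    exact s1.trans (s2.trans s3)
  -- term 2: |X_U (X_L L - I) U| ≤ |X_U| |X_L L - I| |U| ≤ g₂ |X_U||X_L||L||U|
  have t2 : |(XU * (XL * L - 1) * U) i j| ≤ g₂ * (aXU * aXL * aL * aU) i j := by
    have s1 := abs_mul_apply_le (XU * (XL * L - 1)) U i j
    have s2 : ((XU * (XL * L - 1)).map (fun z => |z|) * aU) i j ≤
        (aXU * (XL * L - 1).map (fun z => |z|) * aU) i j :=
      mul_map_abs_le_of_abs_le (fun i j => abs_mul_apply_le XU (XL * L - 1) i j) i j
    have s3 : (aXU * (XL * L - 1).map (fun z => |z|) * aU) i j ≤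
        (aXU * (g₂ • (aXL * aL)) * aU) i j := by
      have hrow : ∀ k l, (aXU * (XL * L - 1).map (fun z => |z|)) k l ≤ (aXU * (g₂ • (aXL * aL))) k l :=
        mul_apply_mono_right hPXU (fun k l => by
          rw [Matrix.map_apply, Matrix.smul_apply, smul_eq_mul]; exact hL k l)
      rw [Matrix.mul_apply, Matrix.mul_apply]
      exact sum_le_sum fun k _ => mul_le_mul_of_nonneg_right (hrow i k)
        (by rw [haU, Matrix.map_apply]; exact abs_nonneg _)
    rw [Matrix.mul_smul, Matrix.smul_mul, Matrix.smul_apply, smul_eq_mul, ← Matrix.mul_assoc] at s3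
    exact s1.trans (s2.trans s3)
  -- term 3
  have t3 : |(XU * U - 1) i j| ≤ g₃ * (aXU * aU) i j := hU i j
  rw [mul_mul_sub_one_eq, Matrix.add_apply, Matrix.add_apply]
  calc |(XU * XL * (B - L * U)) i j + (XU * (XL * L - 1) * U) i j + (XU * U - 1) i j|
      ≤ |(XU * XL * (B - L * U)) i j| + |(XU * (XL * L - 1) * U) i j| + |(XU * U - 1) i j| :=
        (abs_add_le _ _).trans (add_le_add (abs_add_le _ _) le_rfl)
    _ ≤ g₁ * (aXU * aXL * aL * aU) i j + g₂ * (aXU * aXL * aL * aU) i j + g₃ * (aXU * aU) i j :=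
        add_le_add (add_le_add t1 t2) t3
    _ = _ := by ring

omit [LinearOrder K] [IsStrictOrderedRing K] in
/-- row sums as matrix–vector products with `e = (1, …, 1)ᵀ`: `Σ_j (M N)_ij = (M (N e))_i`, the
`O(n²)` evaluation order of (17). [cite: OishiRump2002, Proposition 4.3 (17)] -/
theorem sum_mul_apply_eq_mulVec (M N : Matrix (Fin n) (Fin n) K) (i : Fin n) :
    ∑ j, (M * N) i j = (M *ᵥ (N *ᵥ 1)) i := by
  rw [Matrix.mulVec_mulVec]
  rw [show ((M * N) *ᵥ (1 : Fin n → K)) i = ∑ j, (M * N) i j * (1 : Fin n → K) j from rfl]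
  simp

omit [LinearOrder K] [IsStrictOrderedRing K] in
/-- `Σ_j M_ij = (M e)_i`. [cite: OishiRump2002, Proposition 4.3 (17)] -/
theorem sum_apply_eq_mulVec_one (M : Matrix (Fin n) (Fin n) K) (i : Fin n) :
    ∑ j, M i j = (M *ᵥ 1) i := by
  rw [show (M *ᵥ (1 : Fin n → K)) i = ∑ j, M i j * (1 : Fin n → K) j from rfl]
  simp

/-- OISHI–RUMP PROPOSITION 4.3 (17), no underflow, as the row-sum inequality it asserts: under the
three a-priori bounds (with constants `g₁ g₂ g₃`; printed: all `γ_n`), for every row `i`,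
`Σ_j |(X_U X_L B - I)_ij| ≤ (g₁ + g₂) (|X_U|(|X_L|(|L|(|U|e))))_i + g₃ (|X_U|(|U|e))_i`, hence
`α = ‖X_U X_L PA - I‖_∞ ≤ 2γ_n ‖|X_U|(|X_L|(|L|(|U|e)))‖_∞ + γ_n ‖|X_U|(|U|e)‖_∞`, computable in
`O(n²)` flops. [cite: OishiRump2002, Proposition 4.3 (17)] [cite: OgitaOishi2009, (4.7)] -/
theorem sum_abs_mul_mul_sub_one_le {B L U XL XU : Matrix (Fin n) (Fin n) K} {g₁ g₂ g₃ : K}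
    (hB : ∀ i j, |(B - L * U) i j| ≤ g₁ * (L.map (fun z => |z|) * U.map (fun z => |z|)) i j)
    (hL : ∀ i j, |(XL * L - 1) i j| ≤ g₂ * (XL.map (fun z => |z|) * L.map (fun z => |z|)) i j)
    (hU : ∀ i j, |(XU * U - 1) i j| ≤ g₃ * (XU.map (fun z => |z|) * U.map (fun z => |z|)) i j)
    (i : Fin n) :
    ∑ j, |(XU * XL * B - 1) i j| ≤
      (g₁ + g₂) * (XU.map (fun z => |z|) *ᵥ (XL.map (fun z => |z|) *ᵥ (L.map (fun z => |z|) *ᵥ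
        (U.map (fun z => |z|) *ᵥ 1)))) i + g₃ * (XU.map (fun z => |z|) *ᵥ (U.map (fun z => |z|) *ᵥ 1)) i := by
  refine (sum_le_sum fun j _ => abs_mul_mul_sub_one_le hB hL hU i j).trans (le_of_eq ?_)
  rw [sum_add_distrib, ← mul_sum, ← mul_sum, sum_mul_apply_eq_mulVec, sum_mul_apply_eq_mulVec]
  simp only [Matrix.mulVec_mulVec, ← Matrix.mul_assoc]

/-- THE OGITA–OISHI VARIANT (4.8), no underflow: with only the bound `|X_U U - I| ≤ g |X_U||U|`,
`|I - X_U X_L B| ≤ |X_U| (|X_L B - U| + g |U|)` entrywise, from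
`I - X_U X_L B = (I - X_U U) - X_U (X_L B - U)`; here `B = PA`. [cite: OgitaOishi2009, (4.8)] -/
theorem abs_mul_mul_sub_one_le_residual {B U XL XU : Matrix (Fin n) (Fin n) K} {g : K}
    (hU : ∀ i j, |(XU * U - 1) i j| ≤ g * (XU.map (fun z => |z|) * U.map (fun z => |z|)) i j)
    (i j : Fin n) :
    |(XU * XL * B - 1) i j| ≤
      (XU.map (fun z => |z|) * ((XL * B - U).map (fun z => |z|) + g • U.map (fun z => |z|))) i j := by
  have hid : XU * XL * B - 1 = XU * (XL * B - U) + (XU * U - 1) := by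
    simp only [Matrix.mul_sub, Matrix.mul_assoc]; abel
  rw [hid, Matrix.add_apply, Matrix.mul_add, Matrix.add_apply, Matrix.mul_smul, Matrix.smul_apply,
    smul_eq_mul]
  refine (abs_add_le _ _).trans (add_le_add ?_ (hU i j))
  exact abs_mul_apply_le XU (XL * B - U) i j

/-- (4.8) as the row-sum inequality: `Σ_j |(X_U X_L B - I)_ij| ≤ (|X_U| ((|X_L B - U| + g|U|) e))_i`.
[cite: OgitaOishi2009, (4.8)] -/
theorem sum_abs_mul_mul_sub_one_le_residual {B U XL XU : Matrix (Fin n) (Fin n) K} {g : K}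
    (hU : ∀ i j, |(XU * U - 1) i j| ≤ g * (XU.map (fun z => |z|) * U.map (fun z => |z|)) i j)
    (i : Fin n) :
    ∑ j, |(XU * XL * B - 1) i j| ≤
      (XU.map (fun z => |z|) *ᵥ (((XL * B - U).map (fun z => |z|) + g • U.map (fun z => |z|)) *ᵥ 1)) i := by
  refine (sum_le_sum fun j _ => abs_mul_mul_sub_one_le_residual hU i j).trans (le_of_eq ?_)
  rw [sum_mul_apply_eq_mulVec]

end Chain

/-! ### Over `ℝ` with the `ℓ∞` operator norm: (3)–(4) and the verification of nonsingularity -/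

section Real

open scoped Matrix.Norms.Operator
open Literature.LinearAlgebra.Matrix.BauerFike

variable {n : ℕ}

/-- `(|L| |U|)_ij = Σ_m |L_im| |U_mj|`. [cite: OishiRump2002, Theorem 4.1 (14)] -/
theorem map_abs_mul_apply {K : Type*} [Field K] [LinearOrder K] [IsStrictOrderedRing K]
    (L U : Matrix (Fin n) (Fin n) K) (i j : Fin n) :
    (L.map (fun z => |z|) * U.map (fun z => |z|)) i j = ∑ m, |L i m| * |U m j| := by
  rw [Matrix.mul_apply]; rfl

/-- OISHI–RUMP (3): `‖RA - I‖_∞ < 1 ⟹ A` is nonsingular (and so is `R`). [cite: OishiRump2002, (3)–(4)]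
[cite: OgitaOishi2009, Theorem 4.3] -/
theorem linfty_isUnit_det_of_norm_mul_sub_one_lt {A R : Matrix (Fin n) (Fin n) ℝ}
    (h : ‖R * A - 1‖ < 1) : IsUnit A.det ∧ IsUnit R.det := by
  rw [← norm_neg (R * A - 1), neg_sub] at h
  have hA : IsUnit A.det := linfty_isUnit_det_of_norm_one_sub_mul_lt h
  refine ⟨hA, ?_⟩
  -- `RA` is invertible too, hence so is `R`
  have hRA : IsUnit (R * A).det :=
    linfty_isUnit_det_of_norm_one_sub_mul_lt (U := R * A) (Y := 1) (by rwa [Matrix.one_mul])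
  rw [Matrix.det_mul] at hRA
  exact (IsUnit.mul_iff.mp hRA).1

/-- OISHI–RUMP (4), first inequality: `‖RA - I‖_∞ ≤ α < 1 ⟹ ‖A⁻¹‖_∞ ≤ ‖R‖_∞ / (1 - α)`.
[cite: OishiRump2002, (4)] -/
theorem linfty_norm_inv_le_of_norm_mul_sub_one_le {A R : Matrix (Fin n) (Fin n) ℝ} {α : ℝ}
    (hα : ‖R * A - 1‖ ≤ α) (hα1 : α < 1) : ‖A⁻¹‖ ≤ ‖R‖ / (1 - α) := by
  rw [← norm_neg (R * A - 1), neg_sub] at hα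
  exact linfty_norm_inv_le hα hα1

/-- OISHI–RUMP (4), second inequality (the error bound the whole method delivers): if
`‖RA - I‖_∞ ≤ α < 1` then `A` is nonsingular and for every right-hand side `b` and every `x̃`,
`‖A⁻¹b - x̃‖_∞ ≤ ‖R(Ax̃ - b)‖_∞ / (1 - α)` ("`β/(1 - α)` is an upper bound for `‖A⁻¹b - x̃‖_∞`").
[cite: OishiRump2002, (4) and §5] [cite: OgitaOishi2009, Theorem 4.3] -/
theorem linfty_norm_inv_mulVec_sub_le {A R : Matrix (Fin n) (Fin n) ℝ} {α : ℝ}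
    (hα : ‖R * A - 1‖ ≤ α) (hα1 : α < 1) (b xt : Fin n → ℝ) :
    ‖A⁻¹ *ᵥ b - xt‖ ≤ ‖R *ᵥ (A *ᵥ xt - b)‖ / (1 - α) := by
  have hA : IsUnit A.det := (linfty_isUnit_det_of_norm_mul_sub_one_lt (hα.trans_lt hα1)).1
  set v := A⁻¹ *ᵥ b - xt with hv
  -- `A v = b - A x̃`, so `v = -R(Ax̃ - b) - (RA - I) v`
  have hAv : A *ᵥ v = b - A *ᵥ xt := by
    rw [hv, Matrix.mulVec_sub, Matrix.mulVec_mulVec, Matrix.mul_nonsing_inv A hA, Matrix.one_mulVec]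
  have hid : v = -(R *ᵥ (A *ᵥ xt - b)) - (R * A - 1) *ᵥ v := by
    rw [Matrix.sub_mulVec, Matrix.one_mulVec, ← Matrix.mulVec_mulVec, hAv, Matrix.mulVec_sub,
      Matrix.mulVec_sub]
    abel
  have h1 : ‖v‖ ≤ ‖R *ᵥ (A *ᵥ xt - b)‖ + α * ‖v‖ := by
    calc ‖v‖ = ‖-(R *ᵥ (A *ᵥ xt - b)) - (R * A - 1) *ᵥ v‖ := by rw [← hid]
      _ ≤ ‖-(R *ᵥ (A *ᵥ xt - b))‖ + ‖(R * A - 1) *ᵥ v‖ := norm_sub_le _ _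
      _ ≤ ‖R *ᵥ (A *ᵥ xt - b)‖ + ‖R * A - 1‖ * ‖v‖ := by
          rw [norm_neg]
          exact add_le_add le_rfl (Matrix.linfty_opNorm_mulVec _ _)
      _ ≤ ‖R *ᵥ (A *ᵥ xt - b)‖ + α * ‖v‖ := by gcongr
  rw [le_div_iff₀ (sub_pos.mpr hα1)]
  nlinarith [norm_nonneg v]

/-- From the row-sum bound to `α`: if every row sum of `|X_U X_L B - I|` is `≤ ρ` (`ρ ≥ 0`, e.g. the
right-hand side of (17) maximised over `i`) then `‖X_U X_L B - I‖_∞ ≤ ρ`. [cite: OishiRump2002, Proposition 4.3 (17)] -/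
theorem linfty_norm_mul_mul_sub_one_le {B XL XU : Matrix (Fin n) (Fin n) ℝ} {ρ : ℝ} (hρ : 0 ≤ ρ)
    (h : ∀ i, ∑ j, |(XU * XL * B - 1) i j| ≤ ρ) : ‖XU * XL * B - 1‖ ≤ ρ :=
  linfty_opNorm_le_of_row_sum_le hρ fun i => by simpa only [Real.norm_eq_abs] using h i

/-- THE `2/3 n³` VERIFICATION OF NONSINGULARITY ([OishiRump2002] §§4–5, `u̲ = 0`): let `B = PA` (`P`
the permutation matrix of the pivoting — any matrix will do), let `L, U` be computed from `B` by any variant of Gaussian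
elimination in floating point (`LURun`), and let the rows of `X_L`, `X_U` be computed by substitution
in any order from `Lᵀx = e_i`, `Uᵀx = e_i` (`SubstSweep`), all with unit roundoff `u`, `nu < 1`. If
the (exactly evaluated) bound (17) without its underflow term,
`ρ_i = 2γ_n (|X_U|(|X_L|(|L|(|U|e))))_i + γ_n (|X_U|(|U|e))_i`, satisfies `ρ_i ≤ ρ < 1` for all
rows `i` (`0 ≤ ρ`), then `α = ‖X_U X_L P A - I‖_∞ ≤ ρ < 1`, and `A` (and `PA`) is nonsingular. [cite: OishiRump2002, Proposition 4.3 and §5]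
[cite: OgitaOishi2009, (4.7)] -/
theorem isUnit_det_of_lu_verification {u : ℝ} (hu : 0 ≤ u) (hn : (n : ℝ) * u < 1)
    {A P L U XL XU : Matrix (Fin n) (Fin n) ℝ} (hLU : LURun u (P * A) L U)
    (hXL : ∀ i, SubstSweep u Lᵀ (Pi.single i 1) (XL i))
    (hXU : ∀ i, SubstSweep u Uᵀ (Pi.single i 1) (XU i)) {ρ : ℝ} (hρ0 : 0 ≤ ρ) (hρ1 : ρ < 1)
    (hρ : ∀ i, 2 * gamma u n * (XU.map (fun z => |z|) *ᵥ (XL.map (fun z => |z|) *ᵥ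
        (L.map (fun z => |z|) *ᵥ (U.map (fun z => |z|) *ᵥ 1)))) i +
      gamma u n * (XU.map (fun z => |z|) *ᵥ (U.map (fun z => |z|) *ᵥ 1)) i ≤ ρ) :
    ‖XU * XL * (P * A) - 1‖ ≤ ρ ∧ IsUnit A.det ∧ IsUnit (P * A).det := by
  have hB : ∀ i j, |(P * A - L * U) i j| ≤
      gamma u n * (L.map (fun z => |z|) * U.map (fun z => |z|)) i j := fun i j => by
    rw [Matrix.sub_apply, map_abs_mul_apply]
    exact hLU.abs_sub_mul_le hu hn i j
  have hL : ∀ i j, |(XL * L - 1) i j| ≤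
      gamma u n * (XL.map (fun z => |z|) * L.map (fun z => |z|)) i j := fun i j => by
    rw [map_abs_mul_apply]
    exact abs_inv_mul_sub_one_le hu hn hXL i j
  have hU : ∀ i j, |(XU * U - 1) i j| ≤
      gamma u n * (XU.map (fun z => |z|) * U.map (fun z => |z|)) i j := fun i j => by
    rw [map_abs_mul_apply]
    exact abs_inv_mul_sub_one_le hu hn hXU i j
  have hrows : ∀ i, ∑ j, |(XU * XL * (P * A) - 1) i j| ≤ ρ := fun i => by
    have h := sum_abs_mul_mul_sub_one_le hB hL hU i
    rw [← two_mul] at h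
    exact h.trans (hρ i)
  have hnorm := linfty_norm_mul_mul_sub_one_le hρ0 hrows
  have hdet := linfty_isUnit_det_of_norm_mul_sub_one_lt (R := XU * XL) (A := P * A)
    (hnorm.trans_lt hρ1)
  refine ⟨hnorm, ?_, hdet.1⟩
  have := hdet.1
  rw [Matrix.det_mul] at this
  exact (IsUnit.mul_iff.mp this).2

end Real

/-! ### Sanity: the run predicates are inhabited -/

section Sanity

/-- Sanity (non-vacuity of `SubstSweep`): exact forward substitution (`u = 0`) for the lower
triangular system `[[2, 0], [1, 4]] x = (2, 9)ᵀ`, `x = (1, 2)ᵀ`; row `1` subtracts the one product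
`T₁₀ x₀` with a fused node, row `0` subtracts nothing. -/
example : SubstSweep (0 : ℚ) !![2, 0; 1, 4] ![2, 9] ![1, 2] where
  row i := by
    fin_cases i
    · refine ⟨[], CTree.start 2, List.nodup_nil, by simp, ?_, trivial, by simp [CTree.const],
        by simp [CTree.terms], by simp, ?_⟩
      · intro j hj hT
        fin_cases j <;> simp_all
      · simp [CTree.val]
    · refine ⟨[0], CTree.fsub 8 (CTree.start 9) 1, List.nodup_singleton 0, by simp, ?_, ?_,
        by simp [CTree.const], ?_, by simp, ?_⟩
      · intro j hj _
        fin_cases j <;> simp_all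
      · simp only [CTree.WF, CTree.val, true_and]
        norm_num
      · simp [CTree.terms]
      · simp [CTree.val]
        norm_num

/-- Sanity (non-vacuity of `LURun`): the exact `1 × 1` elimination `6 = 1 · 6` (`u = 0`). -/
example : LURun (0 : ℚ) !![(6 : ℚ)] !![(1 : ℚ)] !![(6 : ℚ)] where
  unit_diag i := by fin_cases i; simp
  lower i j h := absurd h (by rw [Subsingleton.elim i j]; exact lt_irrefl _)
  upper i j h := absurd h (by rw [Subsingleton.elim i j]; exact lt_irrefl _)
  urow i j _ := by
    fin_cases i; fin_cases j
    exact ⟨CTree.start 6, trivial, by simp [CTree.const], by simp [CTree.terms, luProds],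
      by simp [CTree.val]⟩
  lcol i j h := absurd h (by rw [Subsingleton.elim i j]; exact lt_irrefl _)

end Sanity

end Literature.ComputerArithmetic.OishiRump2002
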